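import Mathlib
import Summits.NavierStokesRegularity.NavierStokesRegularity.Theorems.FilamentSkeletonRssAreaLawSlavingExistence
import Summits.NavierStokesRegularity.NavierStokesRegularity.Theorems.FilamentSkeletonRssAreaLawSlavingConeBound

/-!
# Area-law slaving, part 5 — the `Aa`-BLOCK of `FlatJ1G ∧ NearStraightJ1G`, DISCHARGED from slip hypotheses alone
# (`FilamentSkeletonRss`, child crux `TangentSkeletonNearStraight`, stmt-NavierStokesRegularity-28295, line
# `child_tangent_analytic_strip`, ∃-side of the registered stub `stub_analyticClosing`, step (v))

The ∃-crux `TangentSkeletonNearStraight` asks for a skeleton `(X, w, c, Aa)`; three of its conjuncts concern the core areas only: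
  (area law)  `∀ j, Differentiable ℝ (Aa j) ∧ (∀ τ, 0 < Aa j τ) ∧ ∀ τ, w j τ * deriv (Aa j) τ = (3/2 - deriv (w j) τ) * Aa j τ + 4`,
  (cone)      `∀ j τ, Rw^2*Γ*Aa j τ ≤ KA*(Rw^2*Γ+‖X j τ‖^2)`   (`KA` chosen BEFORE `Rb` and `Γ`),
  (floor)     `∀ j τ, Λ⁻¹ ≤ Aa j τ`                              (conjunct of `NearStraightJ1G`).
`slavedArea_block` (this file) produces `Aa` satisfying ALL THREE, in the crux's quantifier order (`∃ KA > 0, ∀ Γ > 0, ∀ data, ∃ Aa`),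
from hypotheses on the slips `w_j` and the escape clause ONLY:
`w_j ∈ C²`, `w_j(c_j) = 0` with unique zero, uniform supercriticality `w_j′ ≥ 3/2 + δ` on the core window `|τ − c_j| ≤ σ₀√Γ`,
`|w_j′| ≤ Λ`, slip floor `m|τ − c_j| ≤ |w_j|`, far barrier `|τ − c_j|/2 − c₀√Γ ≤ |w_j|` beyond `σ₁√Γ`, escape
`cg|τ − c_j| ≤ Rw√Γ + ‖X_j τ‖` — i.e. the area component of the existence problem is SLAVED to the curve/slip component, as
the crux's mechanism sentence says ("the transported areas are slaved (regular solution `Aa(c) = 4/(w′(c)−3/2)`, `Aa ∼ C·s²` on the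
relaxed arms ⇒ cone bound)").  Assembly of parts 2 (`areaLaw_family_exists_with_floor`) and 4 (`areaLaw_cone_bound`).

WHAT THIS DOES NOT DO (census): the remaining `Aa`-dependence of the crux is through the matched kernel of `u` (the areas enter the
Biot–Savart regularisation, hence `v`, hence `w = ⟪v∘X, X′⟫` — a fixed-point coupling at relative order `1/log Γ`) and, in this
line, through `StadiumAnalyticArea` (analytic continuation of `Aa_j` to the stadium with `Re ≥ Aa/2`, `|·| ≤ 2Aa`), which needs the
complex-domain version of part 1 for analytic `w`; neither is addressed here.

HONEST FRAMING: bookkeeping for a HYPOTHETICAL filament skeleton on the NEGATIVE side of a MODEL route (A1G aside); nothing here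
bears on Navier–Stokes regularity or blow-up, and no registered stub is closed by this file.
`--supports stmt-NavierStokesRegularity-28295`.
-/

set_option linter.dupNamespace false

noncomputable section

namespace Summit.NavierStokesRegularity.NavierStokesRegularity.Theorems.AreaLawSlaving

open Set Real

/-- **The `Aa`-block of the child crux, slaved to the slips.**  See the module docstring: `∃ KA > 0` (explicit, Γ-free) such
that for every `Γ > 0` and every `N`-tuple of `C²` slips with unique transversal zeros, core-window supercriticality, slope bound,
slip floor, far barrier and escape (all in waist scaling), there are core areas `Aa` satisfying the area-law conjunct of `FlatJ1G`
LETTER FOR LETTER, the Γ-flat cone conjunct with that `KA`, the floor `Λ⁻¹ ≤ Aa` of `NearStraightJ1G`, and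
`Aa j (c j) = 4/(w_j′(c_j) − 3/2)`. [folklore] -/
theorem slavedArea_block {N : ℕ} {δ σ₀ σ₁ Λ m c₀ cg Rw : ℝ} (hδ : 0 < δ) (hσ₀ : 0 < σ₀) (hσ₁ : σ₀ ≤ σ₁)
    (hm : 0 < m) (hc₀ : 0 ≤ c₀) (hu : 0 < σ₁ / 2 - c₀) (hΛ0 : 0 ≤ Λ) (hcg : 0 < cg) :
    ∃ KA : ℝ, 0 < KA ∧ ∀ Γ : ℝ, 0 < Γ →
      ∀ (w : Fin N → ℝ → ℝ) (c : Fin N → ℝ) (X : Fin N → ℝ → EuclideanSpace ℝ (Fin 3)),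
        (∀ j, ContDiff ℝ 2 (w j)) → (∀ j, w j (c j) = 0) → (∀ j τ, w j τ = 0 → τ = c j) →
        (∀ j s, |s - c j| ≤ σ₀ * √Γ → 3 / 2 + δ ≤ deriv (w j) s) → (∀ j τ, |deriv (w j) τ| ≤ Λ) →
        (∀ j τ, m * |τ - c j| ≤ |w j τ|) →
        (∀ j τ, σ₁ * √Γ ≤ |τ - c j| → |τ - c j| / 2 - c₀ * √Γ ≤ |w j τ|) →
        (∀ j τ, cg * |τ - c j| ≤ Rw * √Γ + ‖X j τ‖) →
        ∃ Aa : Fin N → ℝ → ℝ,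
          (∀ j, Differentiable ℝ (Aa j) ∧ (∀ τ, 0 < Aa j τ) ∧
            ∀ τ, w j τ * deriv (Aa j) τ = (3 / 2 - deriv (w j) τ) * Aa j τ + 4) ∧
          (∀ j τ, Rw ^ 2 * Γ * Aa j τ ≤ KA * (Rw ^ 2 * Γ + ‖X j τ‖ ^ 2)) ∧
          (∀ j τ, Λ⁻¹ ≤ Aa j τ) ∧
          (∀ j, Aa j (c j) = 4 / (deriv (w j) (c j) - 3 / 2)) := by
  obtain ⟨KA, hKA, hcone⟩ := areaLaw_cone_bound (Rw := Rw) hδ hσ₀ hσ₁ hm hc₀ hu hΛ0 hcg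
  refine ⟨KA, hKA, ?_⟩
  intro Γ hΓ w c X hw hc huniq hsup hΛ hfloor hfar hesc
  have hsupc : ∀ j, 3 / 2 < deriv (w j) (c j) := by
    intro j
    have h := hsup j (c j) (by rw [sub_self, abs_zero]; positivity)
    linarith
  obtain ⟨Aa, hAa, hAc, hfl⟩ := areaLaw_family_exists_with_floor hw hc hsupc huniq hΛ
  refine ⟨Aa, hAa, ?_, hfl, hAc⟩
  intro j τ
  exact hcone Γ hΓ (w j) (Aa j) (c j) (X j) ((hw j).differentiable two_ne_zero) (hAa j).1 (hAa j).2.2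
    (hAa j).2.1 (hc j) (hsup j) (hΛ j) (hfloor j) (hfar j) (hesc j) τ

/-- **Corollary in the `∃ Γ₂, ∀ Γ ≥ Γ₂` letter of the crux** (any `Γ₂ > 0` works for the area block; the crux's `Γ₂` is dictated by
the curve component). [folklore] -/
theorem slavedArea_block_eventually {N : ℕ} {δ σ₀ σ₁ Λ m c₀ cg Rw : ℝ} (hδ : 0 < δ) (hσ₀ : 0 < σ₀) (hσ₁ : σ₀ ≤ σ₁)
    (hm : 0 < m) (hc₀ : 0 ≤ c₀) (hu : 0 < σ₁ / 2 - c₀) (hΛ0 : 0 ≤ Λ) (hcg : 0 < cg) {Γ₂ : ℝ} (hΓ₂ : 0 < Γ₂) :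
    ∃ KA : ℝ, 0 < KA ∧ ∀ Γ : ℝ, Γ₂ ≤ Γ →
      ∀ (w : Fin N → ℝ → ℝ) (c : Fin N → ℝ) (X : Fin N → ℝ → EuclideanSpace ℝ (Fin 3)),
        (∀ j, ContDiff ℝ 2 (w j)) → (∀ j, w j (c j) = 0) → (∀ j τ, w j τ = 0 → τ = c j) →
        (∀ j s, |s - c j| ≤ σ₀ * √Γ → 3 / 2 + δ ≤ deriv (w j) s) → (∀ j τ, |deriv (w j) τ| ≤ Λ) →
        (∀ j τ, m * |τ - c j| ≤ |w j τ|) →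
        (∀ j τ, σ₁ * √Γ ≤ |τ - c j| → |τ - c j| / 2 - c₀ * √Γ ≤ |w j τ|) →
        (∀ j τ, cg * |τ - c j| ≤ Rw * √Γ + ‖X j τ‖) →
        ∃ Aa : Fin N → ℝ → ℝ,
          (∀ j, Differentiable ℝ (Aa j) ∧ (∀ τ, 0 < Aa j τ) ∧
            ∀ τ, w j τ * deriv (Aa j) τ = (3 / 2 - deriv (w j) τ) * Aa j τ + 4) ∧
          (∀ j τ, Rw ^ 2 * Γ * Aa j τ ≤ KA * (Rw ^ 2 * Γ + ‖X j τ‖ ^ 2)) ∧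
          (∀ j τ, Λ⁻¹ ≤ Aa j τ) ∧
          (∀ j, Aa j (c j) = 4 / (deriv (w j) (c j) - 3 / 2)) := by
  obtain ⟨KA, hKA, h⟩ := slavedArea_block (N := N) (Rw := Rw) hδ hσ₀ hσ₁ hm hc₀ hu hΛ0 hcg
  exact ⟨KA, hKA, fun Γ hΓ => h Γ (hΓ₂.trans_le hΓ)⟩

end Summit.NavierStokesRegularity.NavierStokesRegularity.Theorems.AreaLawSlaving

end
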